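import Literature.Algebra.GroupRings.CharpolyQuotientRankTwoModules
import Mathlib.RepresentationTheory.Intertwining
import Mathlib.Tactic
import HarnessLib

/-!
# Boston–Lenstra–Ribet, equivariant form: `σ ≃ ρ^{(ι)}` as representations

Repackaging of `exists_linearEquiv_finsupp_of_charpolyRel` (`CharpolyQuotientRankTwoModules.lean`,
the module form of [BostonLenstraRibet1991, Thm. 1]) in Mathlib's `Representation` language: under
the Cayley–Hamilton relations and surjectivity of `MonoidAlgebra.lift ρ`, there are an index type
`ι` and a `G`-EQUIVARIANT `k`-linear isomorphism `M ≃ (ι →₀ k²)` onto the direct sum of copies of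
the standard representation `V_ρ = (g ↦ (v ↦ ρ(g) v))`, i.e. a `Representation.Equiv σ (V_ρ.finsupp ι)`.
-/

namespace Literature.Algebra.GroupRings

open MonoidAlgebra

universe u

section Equiv

variable {k : Type*} [Field k] {G : Type*} [Group G]

/-- The representation `V.finsupp ι` acts coordinatewise: `(V.finsupp ι g f) i = V g (f i)`.
Private plumbing. [folklore] -/
private theorem finsupp_apply_apply {W : Type*} [AddCommGroup W] [Module k W]
    (V : Representation k G W) (ι : Type*) (g : G) (f : ι →₀ W) (i : ι) :
    (V.finsupp ι g f) i = V g (f i) := by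
  classical
  induction f using Finsupp.induction_linear with
  | zero => simp
  | add f₁ f₂ h₁ h₂ => rw [map_add, Finsupp.add_apply, h₁, h₂, Finsupp.add_apply, map_add]
  | single j w =>
    rw [Representation.finsupp_single, Finsupp.single_apply, Finsupp.single_apply]
    split_ifs <;> simp

/-- **Boston–Lenstra–Ribet, Thm. 1, equivariant form.** If `ρ : G → M₂(k)` is multiplicative with
`MonoidAlgebra.lift ρ` onto `M₂(k)` and the representation `σ` of `G` on `M` satisfies
`σ(g)² - tr ρ(g) σ(g) + det ρ(g) = 0` for all `g`, then `σ` is isomorphic, as a representation, to a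
direct sum of copies of the standard representation `g ↦ (v ↦ ρ(g) v)` on `k²`.
[cite: BostonLenstraRibet1991, Thm. 1] -/
theorem exists_representationEquiv_finsupp_of_charpolyRel (ρ : G →* Matrix (Fin 2) (Fin 2) k)
    (hρ : Function.Surjective (MonoidAlgebra.lift k (Matrix (Fin 2) (Fin 2) k) G ρ))
    {M : Type u} [AddCommGroup M] [Module k M] (σ : Representation k G M)
    (hσ : ∀ g : G, σ g * σ g - (ρ g).trace • σ g + (ρ g).det • (1 : Module.End k M) = 0) :
    ∃ ι : Type u, Nonempty (σ.Equiv (Representation.finsupp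
      ((Representation.ofDistribMulAction k (Matrix (Fin 2) (Fin 2) k) (Fin 2 → k)).comp ρ) ι)) := by
  classical
  set V : Representation k G (Fin 2 → k) :=
    (Representation.ofDistribMulAction k (Matrix (Fin 2) (Fin 2) k) (Fin 2 → k)).comp ρ with hV
  obtain ⟨ι, ⟨e⟩⟩ := exists_linearEquiv_finsupp_of_charpolyRel ρ hρ σ hσ
  refine ⟨ι, ⟨?_⟩⟩
  -- the underlying `k`-linear isomorphism
  let E : M ≃ₗ[k] (ι →₀ (Fin 2 → k)) :=
    σ.asModuleEquiv.symm.trans ((e.restrictScalars k).trans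
      (Finsupp.mapRange.linearEquiv V.asModuleEquiv))
  have hE : ∀ (m : M) (i : ι), E m i = V.asModuleEquiv (e (σ.asModuleEquiv.symm m) i) := by
    intro m i
    simp [E]
  refine Representation.Equiv.mk E fun g => LinearMap.ext fun m => Finsupp.ext fun i => ?_
  change E (σ g m) i = (V.finsupp ι g (E m)) i
  rw [finsupp_apply_apply, hE, hE, Representation.asModuleEquiv_symm_map_rho, map_smul,
    Finsupp.smul_apply]
  -- `of g • v = V g v` on `V.asModule`
  have : ∀ v : V.asModule, V.asModuleEquiv (MonoidAlgebra.of k G g • v)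
      = V g (V.asModuleEquiv v) := fun v => by
    rw [Representation.asModuleEquiv_map_smul, Representation.asAlgebraHom_of]
  exact this _

end Equiv

end Literature.Algebra.GroupRings
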